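import Summits.CriticalPhenomena.PercolationContinuityZ3.Theorems.BudgetTightness.Negative.AboveSix
import Literature.Probability.Percolation.SharpnessDCTProofs

/-!
# `BudgetTightness` (crux stmt-CriticalPhenomena-5248) — negative lemma: every aspect `l ≤ 3` fails above six dimensions

Sequel to `AboveSix.lean` (aspect 2). Translating Aizenman's cube `Λ_n` by `2n e₁` instead of `n e₁`
sends its left face into `Λ_n` and its right face onto `{x₁ = 3n} ⊆ ∂ⁱⁿΛ_{3n}`, so `k + 1` distinct
spanning clusters (which survive the closing of any `k` edges, `bulkSpanning_sdiff_of_numSpanning`) give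
an open crossing of the ASPECT-3 annulus `Λ_n → ∂ⁱⁿΛ_{3n}` inside `Λ_{3n}`
(`relabel_shift_two_mem_crossing_three`). Hence in every `d > 6` with `TwoPointBoundedRatio d`:
`budgetTightness_aspect_three_false_above_six`. Since thicker annuli are easier to block
(`real_budgetEvent_mono_aspect`, first exit, almost surely), the aspect-3 refutation covers every aspect
`l ≤ 3` of the crux's `∃ l` at once: `budgetTightness_aspect_le_three_false_above_six`. (Aspects `l ≥ 4`
would need Aizenman's count for slabs of aspect `(l-1)/2`, which is not vendored.)

References: M. Aizenman, Nuclear Phys. B 485 (1997), Thm. 4 (3).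
-/

noncomputable section

open MeasureTheory ProbabilityTheory Filter Topology
open scoped ENNReal
open Literature.Probability.Percolation Literature.Probability.LatticeModels
open Literature.Probability.Percolation.DCT16 (pathIn_of_mem_openConnIn mem_openConnIn_of_pathIn)
open Literature.Barriers.CriticalPhenomena

namespace Summit.CriticalPhenomena.PercolationContinuityZ3.Theorems.BudgetTightness.Negative

/-! ## Aspect monotonicity (almost sure) -/

/-- For `n < m`, points of `B(n)` are not on the inner vertex boundary of `B(m)`. [folklore] -/
theorem not_mem_innerBoundary_of_mem_box {d n m : ℕ} (hnm : n < m) {y : Site d} (hy : y ∈ box d n) :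
    y ∉ innerBoundary (zdGraph d) (box d m) := by
  intro hyb
  rw [mem_innerBoundary_iff] at hyb
  obtain ⟨hym, z, hz, hadj⟩ := hyb
  rw [mem_box] at hy hym hz
  rw [zdGraph_adj_iff] at hadj
  obtain ⟨i, h | h⟩ := hadj
  · apply hz; intro i'
    by_cases hi : i' = i
    · subst hi; have := hy i'; rw [h]; simp; omega
    · have := hym i'; rw [h]; simp [Pi.single_eq_of_ne hi]; omega
  · apply hz; intro i'
    have hyi : y i' = z i' + (Pi.single i (1 : ℤ) : Site d) i' := by rw [h]; rfl
    by_cases hi : i' = i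
    · subst hi; have := hy i'; simp at hyi; omega
    · have := hym i'; simp [Pi.single_eq_of_ne hi] at hyi; omega

/-- **Thicker annuli are easier to block** (lattice configurations `ω ⊆ E(ℤ^d)`, `n ≤ m ≤ m'`): a
crossing of `B(n) → ∂ⁱⁿB(m')` inside `B(m')` in `ω \ S` exits `B(m)` through `∂ⁱⁿB(m)` (first exit).
[folklore] -/
theorem budgetEvent_mono_aspect {d k n m m' : ℕ} (hnm : n ≤ m) (hmm' : m ≤ m') {ω : BondConfig (Site d)}
    (hωE : ω ⊆ (zdGraph d).edgeSet)
    (hω : ω ∈ {ω : BondConfig (Site d) | ∃ S : Finset (Sym2 (Site d)), S.card ≤ k ∧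
      ¬ ∃ x ∈ box d n, ∃ y ∈ innerBoundary (zdGraph d) (box d m),
        (ω \ ↑S) ∈ openConnIn (↑(box d m) : Set (Site d)) x y}) :
    ω ∈ {ω : BondConfig (Site d) | ∃ S : Finset (Sym2 (Site d)), S.card ≤ k ∧
      ¬ ∃ x ∈ box d n, ∃ y ∈ innerBoundary (zdGraph d) (box d m'),
        (ω \ ↑S) ∈ openConnIn (↑(box d m') : Set (Site d)) x y} := by
  rcases hmm'.eq_or_lt with rfl | hlt
  · exact hω
  obtain ⟨S, hSk, hS⟩ := hω
  refine ⟨S, hSk, ?_⟩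
  rintro ⟨x, hx, y, hy, hconn⟩
  apply hS
  have hP := pathIn_of_mem_openConnIn hconn
  have hxm : x ∈ (↑(box d m) : Set (Site d)) := Finset.mem_coe.2 (box_mono d hnm hx)
  have hym : y ∉ (↑(box d m) : Set (Site d)) := fun h =>
    not_mem_innerBoundary_of_mem_box hlt (Finset.mem_coe.1 h) hy
  obtain ⟨a, b, ha, hb, -, hadj, hpath⟩ := hP.exit hxm hym
  have hadjG : (zdGraph d).Adj a b := by
    rw [openGraph_adj] at hadj
    exact hωE hadj.1.1
  have haIB : a ∈ innerBoundary (zdGraph d) (box d m) :=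
    mem_innerBoundary_iff.2 ⟨Finset.mem_coe.1 ha, b, fun h => hb (Finset.mem_coe.2 h), hadjG⟩
  exact ⟨x, hx, a, haIB, mem_openConnIn_of_pathIn (hpath.mono Set.inter_subset_left)⟩

/-- **`P_p(blocked_k(n, m)) ≤ P_p(blocked_k(n, m'))` for `n ≤ m ≤ m'`.** [folklore] -/
theorem real_budgetEvent_mono_aspect {d : ℕ} (p : unitInterval) (k : ℕ) {n m m' : ℕ} (hnm : n ≤ m)
    (hmm' : m ≤ m') :
    (bondPercolation (zdGraph d) p).real
        {ω : BondConfig (Site d) | ∃ S : Finset (Sym2 (Site d)), S.card ≤ k ∧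
          ¬ ∃ x ∈ box d n, ∃ y ∈ innerBoundary (zdGraph d) (box d m),
            (ω \ ↑S) ∈ openConnIn (↑(box d m) : Set (Site d)) x y} ≤
      (bondPercolation (zdGraph d) p).real
        {ω : BondConfig (Site d) | ∃ S : Finset (Sym2 (Site d)), S.card ≤ k ∧
          ¬ ∃ x ∈ box d n, ∃ y ∈ innerBoundary (zdGraph d) (box d m'),
            (ω \ ↑S) ∈ openConnIn (↑(box d m') : Set (Site d)) x y} := by
  refine ENNReal.toReal_mono (measure_ne_top _ _) (measure_mono_ae ?_)
  have hsub : ∀ᵐ ω ∂(bondPercolation (zdGraph d) p), ω ⊆ (zdGraph d).edgeSet :=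
    ProbabilityTheory.setBernoulli_ae_subset
  filter_upwards [hsub] with ω hωE hω
  exact budgetEvent_mono_aspect hnm hmm' hωE hω

/-! ## Translation by `2n e₁` -/

/-- Translating the left face of `Λ_n` by `2n e₁` lands in `Λ_n`. [folklore] -/
theorem add_single_two_mem_box_of_mem_leftFace {d n : ℕ} [NeZero d] {x : Site d}
    (hx : x ∈ leftFace d n) : x + Pi.single 0 ((2 * n : ℕ) : ℤ) ∈ box d n := by
  obtain ⟨hxb, hx0⟩ := hx
  rw [mem_box] at hxb ⊢
  intro i
  by_cases hi : i = 0
  · subst hi; simp [hx0]; omega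
  · have := hxb i; simp [Pi.single_eq_of_ne hi, this]

/-- Translating the right face of `Λ_n` by `2n e₁` lands on `{x₁ = 3n} ⊆ ∂ⁱⁿΛ_{3n}`. [folklore] -/
theorem add_single_two_mem_innerBoundary_of_mem_rightFace {d n : ℕ} [NeZero d] {y : Site d}
    (hy : y ∈ rightFace d n) :
    y + Pi.single 0 ((2 * n : ℕ) : ℤ) ∈ innerBoundary (zdGraph d) (box d (3 * n)) := by
  obtain ⟨hyb, hy0⟩ := hy
  rw [mem_box] at hyb
  rw [mem_innerBoundary_iff]
  refine ⟨?_, y + Pi.single 0 ((2 * n : ℕ) : ℤ) + Pi.single 0 1, ?_, ?_⟩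
  · rw [mem_box]
    intro i
    by_cases hi : i = 0
    · subst hi; simp [hy0]; omega
    · have := hyb i; simp [Pi.single_eq_of_ne hi]; omega
  · rw [mem_box]
    intro h
    have := (h 0).2
    simp [hy0] at this
    omega
  · rw [zdGraph_adj_iff]
    exact ⟨0, Or.inl rfl⟩

/-- **Bulk spanning of `Λ_n`, translated by `2n e₁`, crosses the aspect-3 annulus inside `Λ_{3n}`**
(first exit; lattice configurations). [folklore] -/
theorem relabel_shift_two_mem_crossing_three {d n : ℕ} [NeZero d] {ω : BondConfig (Site d)}
    (hωE : ω ⊆ (zdGraph d).edgeSet) (hω : ω ∈ bulkSpanning d n) :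
    BondConfig.relabel (sym2Equiv (Site.shift (Pi.single 0 ((2 * n : ℕ) : ℤ)))) ω ∈
      {ω' : BondConfig (Site d) | ∃ x ∈ box d n, ∃ y ∈ innerBoundary (zdGraph d) (box d (3 * n)),
        ω' ∈ openConnIn (↑(box d (3 * n)) : Set (Site d)) x y} := by
  classical
  set v : Site d := Pi.single 0 ((2 * n : ℕ) : ℤ) with hv
  obtain ⟨x, hx, y, hy, hconn⟩ := hω
  set ω' : BondConfig (Site d) := BondConfig.relabel (sym2Equiv (Site.shift v)) ω with hω'
  let φ : openGraph ω ≃g openGraph ω' :=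
    { toEquiv := Site.shift v
      map_rel_iff' := fun {a b} => openGraph_relabel_adj_iff (Site.shift v) ω a b }
  have hconn' : (openGraph ω').Reachable (x + v) (y + v) := SimpleGraph.Reachable.map φ.toHom hconn
  have hω'sub : ω' ⊆ (zdGraph d).edgeSet := by
    intro z hz
    rw [hω', BondConfig.mem_relabel_iff] at hz
    have hzE : (sym2Equiv (Site.shift v)).symm z ∈ (zdGraph d).edgeSet := hωE hz
    let ψ : zdGraph d ≃g zdGraph d :=
      { toEquiv := Site.shift v
        map_rel_iff' := fun {a b} => zdGraph_adj_shift_iff v a b }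
    have key := sym2Equiv_mem_edgeSet_iff ψ ((sym2Equiv (Site.shift v)).symm z)
    have hz' : sym2Equiv ψ.toEquiv ((sym2Equiv (Site.shift v)).symm z) = z :=
      (sym2Equiv (Site.shift v)).apply_symm_apply z
    rw [hz'] at key
    exact key.2 hzE
  have hle : openGraph ω' ≤ zdGraph d := openGraph_le_of_subset hω'sub
  obtain ⟨w⟩ := hconn'
  have hxn : x + v ∈ box d n := add_single_two_mem_box_of_mem_leftFace hx
  have hxv : x + v ∈ box d (3 * n) := box_mono d (by omega) hxn
  have hyv : y + v ∈ innerBoundary (zdGraph d) (box d (3 * n)) :=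
    add_single_two_mem_innerBoundary_of_mem_rightFace hy
  obtain ⟨b, hb, hu, hb', hreach⟩ :=
    exists_innerBoundary_reachable_of_walk_end hle (box d (3 * n)) w hxv (fun _ => hyv)
  exact ⟨x + v, hxn, b, hb, hu, hb', hreach⟩

/-- Measurability of the aspect-3 budget event (`{MinCut ≤ k}`). [folklore] -/
theorem measurableSet_blockedThree (d k n : ℕ) :
    MeasurableSet {ω : BondConfig (Site d) | ∃ S : Finset (Sym2 (Site d)), S.card ≤ k ∧
      ¬ ∃ x ∈ box d n, ∃ y ∈ innerBoundary (zdGraph d) (box d (3 * n)),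
        (ω \ ↑S) ∈ openConnIn (↑(box d (3 * n)) : Set (Site d)) x y} := by
  have hset : {ω : BondConfig (Site d) | ∃ S : Finset (Sym2 (Site d)), S.card ≤ k ∧
      ¬ ∃ x ∈ box d n, ∃ y ∈ innerBoundary (zdGraph d) (box d (3 * n)),
        (ω \ ↑S) ∈ openConnIn (↑(box d (3 * n)) : Set (Site d)) x y} =
      {ω | minOpenCutIn (↑(box d (3 * n)) : Set (Site d)) ↑(box d n)
        ↑(innerBoundary (zdGraph d) (box d (3 * n))) ω ≤ k} := by
    ext ω
    rw [Set.mem_setOf_eq, Set.mem_setOf_eq, minOpenCutIn_le_iff]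
    simp only [Finset.mem_coe]
  rw [hset]
  exact measurableSet_setOf_minOpenCutIn_le (Finset.finite_toSet _) _ _ k

/-- **`P_{p_c}(blocked_k(n, 3n)) ≤ 1 - P_{p_c}(N_n ≥ k + 1)`** (translation by `2n e₁`). [folklore] -/
theorem real_blockedThree_le_one_sub {d : ℕ} [NeZero d] (k n : ℕ) :
    (bondPercolation (zdGraph d) (criticalProbI d)).real
        {ω : BondConfig (Site d) | ∃ S : Finset (Sym2 (Site d)), S.card ≤ k ∧
          ¬ ∃ x ∈ box d n, ∃ y ∈ innerBoundary (zdGraph d) (box d (3 * n)),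
            (ω \ ↑S) ∈ openConnIn (↑(box d (3 * n)) : Set (Site d)) x y} ≤
      1 - (bondPercolation (zdGraph d) (criticalProbI d)).real
        {ω | ENNReal.ofReal ((k : ℝ) + 1) ≤ (numSpanningClusters d n ω : ℝ≥0∞)} := by
  set μ := bondPercolation (zdGraph d) (criticalProbI d) with hμ
  set B : Set (BondConfig (Site d)) := {ω | ∃ S : Finset (Sym2 (Site d)), S.card ≤ k ∧
      ¬ ∃ x ∈ box d n, ∃ y ∈ innerBoundary (zdGraph d) (box d (3 * n)),
        (ω \ ↑S) ∈ openConnIn (↑(box d (3 * n)) : Set (Site d)) x y} with hB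
  set v : Site d := Pi.single 0 ((2 * n : ℕ) : ℤ) with hv
  set T := BondConfig.relabel (sym2Equiv (Site.shift v)) with hT
  have hpt : ∀ ω : BondConfig (Site d), ω ⊆ (zdGraph d).edgeSet →
      ENNReal.ofReal ((k : ℝ) + 1) ≤ (numSpanningClusters d n ω : ℝ≥0∞) → T ω ∈ Bᶜ := by
    intro ω hωE hNω
    have hN : ((k + 1 : ℕ) : ℕ∞) ≤ numSpanningClusters d n ω := by
      have e0 : ((k : ℝ) + 1) = ((k + 1 : ℕ) : ℝ) := by push_cast; ring
      have e1 : ENNReal.ofReal ((k : ℝ) + 1) = ((k + 1 : ℕ) : ℕ∞) := by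
        rw [e0, ENNReal.ofReal_natCast]
        rfl
      rw [e1] at hNω
      exact ENat.toENNReal_le.1 hNω
    rintro ⟨S', hS'k, hS'⟩
    apply hS'
    set S : Finset (Sym2 (Site d)) := S'.map (sym2Equiv (Site.shift v)).symm.toEmbedding with hSdef
    have hSk : S.card ≤ k := by rw [hSdef, Finset.card_map]; exact hS'k
    have hspan := bulkSpanning_sdiff_of_numSpanning hN hSk
    have hsub : ω \ ↑S ⊆ (zdGraph d).edgeSet := Set.sdiff_subset.trans hωE
    have hcross := relabel_shift_two_mem_crossing_three hsub hspan
    have hTS : BondConfig.relabel (sym2Equiv (Site.shift v)) (ω \ ↑S) = T ω \ ↑S' := by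
      rw [hT, BondConfig.relabel_apply, BondConfig.relabel_apply,
        Set.image_sdiff (sym2Equiv (Site.shift v)).injective, hSdef, Finset.coe_map,
        Equiv.coe_toEmbedding, Equiv.image_symm_image]
    rw [hTS] at hcross
    exact hcross
  have hae : ∀ᵐ ω ∂μ, ω ∈ {ω | ENNReal.ofReal ((k : ℝ) + 1) ≤ (numSpanningClusters d n ω : ℝ≥0∞)} →
      ω ∈ T ⁻¹' Bᶜ := by
    have hsub : ∀ᵐ ω ∂μ, ω ⊆ (zdGraph d).edgeSet := ProbabilityTheory.setBernoulli_ae_subset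
    filter_upwards [hsub] with ω hω hN
    exact hpt ω hω hN
  have h1 : μ.real {ω | ENNReal.ofReal ((k : ℝ) + 1) ≤ (numSpanningClusters d n ω : ℝ≥0∞)} ≤
      μ.real (T ⁻¹' Bᶜ) :=
    ENNReal.toReal_mono (measure_ne_top _ _) (measure_mono_ae hae)
  have h2 : μ.real (T ⁻¹' Bᶜ) = μ.real Bᶜ := bondPercolation_real_preimage_shift v _ _
  have h3 : μ.real Bᶜ = 1 - μ.real B := by
    rw [measureReal_compl (measurableSet_blockedThree d k n), probReal_univ]
  linarith

/-- **NEGATIVE LEMMA — the crux at aspect 3 is FALSE above six dimensions** (granted (t-c) with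
`η = 0`): Aizenman 1997 Thm. 4 (3) via `SpanningClustersAboveSix_holds`. [cite: Aizenman1997, Thm. 4 (3)] -/
theorem budgetTightness_aspect_three_false_above_six {d : ℕ} [NeZero d] (hd : 6 < d)
    (hτ : TwoPointBoundedRatio d) :
    ¬ ∃ (k : ℕ) (c : ℝ), 0 < c ∧ ∀ N : ℕ, ∃ n : ℕ, N ≤ n ∧
      c ≤ (bondPercolation (zdGraph d) (criticalProbI d)).real
        {ω : BondConfig (Site d) | ∃ S : Finset (Sym2 (Site d)), S.card ≤ k ∧
          ¬ ∃ x ∈ box d n, ∃ y ∈ innerBoundary (zdGraph d) (box d (3 * n)),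
            (ω \ ↑S) ∈ openConnIn (↑(box d (3 * n)) : Set (Site d)) x y} := by
  rintro ⟨k, c, hc, h⟩
  have hT := SpanningClustersAboveSix_holds.numSpanning_ge_tendsto_one hd hτ ((k : ℝ) + 1)
  have hev := hT.eventually (lt_mem_nhds (show (1 : ℝ) - c < 1 by linarith))
  obtain ⟨N, hN⟩ := Filter.eventually_atTop.1 hev
  obtain ⟨n, hn, hcn⟩ := h N
  have := real_blockedThree_le_one_sub (d := d) k n
  linarith [hN n hn]

/-- **Every aspect `l ≤ 3` of the crux fails above six dimensions** (granted (t-c)): in the crux's own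
shape `∃ k l c, … (l * n) …` restricted to `l ≤ 3` there is no witness in `d > 6` (`l ≤ 1` void,
`l ∈ {2, 3}` by aspect monotonicity and the aspect-3 refutation). So any proof of r2 producing an aspect
`l ≤ 3` must use a property of `ℤ³` failing above six dimensions. [cite: Aizenman1997, Thm. 4 (3)] -/
theorem budgetTightness_aspect_le_three_false_above_six {d : ℕ} [NeZero d] (hd : 6 < d)
    (hτ : TwoPointBoundedRatio d) :
    ¬ ∃ (k l : ℕ) (c : ℝ), l ≤ 3 ∧ 0 < c ∧ ∀ N : ℕ, ∃ n : ℕ, N ≤ n ∧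
      c ≤ (bondPercolation (zdGraph d) (criticalProbI d)).real
        {ω : BondConfig (Site d) | ∃ S : Finset (Sym2 (Site d)), S.card ≤ k ∧
          ¬ ∃ x ∈ box d n, ∃ y ∈ innerBoundary (zdGraph d) (box d (l * n)),
            (ω \ ↑S) ∈ openConnIn (↑(box d (l * n)) : Set (Site d)) x y} := by
  rintro ⟨k, l, c, hl, hc, h⟩
  rcases Nat.lt_or_ge l 1 with h0 | h1
  · -- `l = 0`: the event is empty (corner of `B(n)` joined to itself), probability `0 < c`
    obtain ⟨n, -, hcn⟩ := h 0
    have hl0 : l = 0 := by omega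
    subst hl0
    rw [zero_mul] at hcn
    have hempty : {ω : BondConfig (Site d) | ∃ S : Finset (Sym2 (Site d)), S.card ≤ k ∧
        ¬ ∃ x ∈ box d n, ∃ y ∈ innerBoundary (zdGraph d) (box d 0),
          (ω \ ↑S) ∈ openConnIn (↑(box d 0) : Set (Site d)) x y} = ∅ :=
      blocked_eq_empty_of_le' k (Nat.zero_le n)
    rw [hempty, measureReal_empty] at hcn
    exact absurd hcn (not_le.2 hc)
  · refine budgetTightness_aspect_three_false_above_six hd hτ ⟨k, c, hc, fun N => ?_⟩
    obtain ⟨n, hn, hcn⟩ := h N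
    exact ⟨n, hn, hcn.trans (real_budgetEvent_mono_aspect _ k (by nlinarith) (by nlinarith))⟩
where
  -- local copy of `ParameterOne.blocked_eq_empty_of_le` (degenerate aspect), keeping this file's import
  -- cone independent of it
  blocked_eq_empty_of_le' {d : ℕ} [NeZero d] (k : ℕ) {n m : ℕ} (h : m ≤ n) :
      {ω : BondConfig (Site d) | ∃ S : Finset (Sym2 (Site d)), S.card ≤ k ∧
        ¬ ∃ x ∈ box d n, ∃ y ∈ innerBoundary (zdGraph d) (box d m),
          (ω \ ↑S) ∈ openConnIn (↑(box d m) : Set (Site d)) x y} = ∅ := by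
    ext ω
    simp only [Set.mem_empty_iff_false, iff_false, Set.mem_setOf_eq]
    rintro ⟨S, -, hS⟩
    have hx : (fun _ => (m : ℤ) : Site d) ∈ box d n := by
      rw [mem_box]; intro i; constructor <;> omega
    have hy : (fun _ => (m : ℤ) : Site d) ∈ innerBoundary (zdGraph d) (box d m) := by
      rw [mem_innerBoundary_iff]
      refine ⟨?_, (fun _ => (m : ℤ)) + Pi.single 0 1, ?_, ?_⟩
      · rw [mem_box]; intro i; constructor <;> omega
      · rw [mem_box]; intro hcon
        have := (hcon 0).2
        simp at this
      · rw [zdGraph_adj_iff]; exact ⟨0, Or.inl rfl⟩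
    refine hS ⟨_, hx, _, hy, ?_⟩
    have hxm : (fun _ => (m : ℤ) : Site d) ∈ (↑(box d m) : Set (Site d)) :=
      Finset.mem_coe.2 (mem_innerBoundary_iff.1 hy).1
    exact ⟨hxm, hxm, SimpleGraph.Reachable.refl _⟩

end Summit.CriticalPhenomena.PercolationContinuityZ3.Theorems.BudgetTightness.Negative
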